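import Summits.HodgeConjecture.HodgeConjecture.Theorems.F0P3cStCharTSSocketsOut   -- ★ (LH6-p02 g4) `packetCharHRegularity_of_regH`, `isStableClassFunOn_mono` (brings ★ `Ch12Sec5Inputs` ∕ `Ch12Sec5Defs`)
import Literature.NumberTheory.Rogawski1990.LocalTransferFundamentalLemma          -- ★ `IsLocSmooth` (`C_c^∞`: locally constant, compact support)
import Literature.NumberTheory.Rogawski1990.CMLocalAPacketMembers                  -- ★ organ vocabulary `Gqs`, `qsForm` (for the `U(Φ₃)(L⁺_v)`-side instance)
import HarnessLib

/-!
# F0 · P3c · line LH6 «StCharTS» — «M1H-OF-CHARH★» (datum road S12b, hypothesis form): the socket (M1H) `PacketCharHRegularity`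
# of (S-𝔇) FROM a per-class character family on `H` + the print residue «`χ_ρ` is a stable class function on `H^r`» [Rogawski1990, §1.6 pp. 5–6; §12.5 p. 183]

Cell `pub/hodgecm-mathlib`, crux H413 = `stmt-HodgeConjecture-24833` (lane `--supports …`), route HCCMUnconditional; seat F0P2-p01 (g21)
(free P2 hand on LH6-p01 (g4)'s datum road, self-offer S12b under road rule §2.3).  THEOREMS ONLY (no definition ∕ instance ∕ notation ∕ named
fact ∕ `sorry`); ★-only imports.  MAP: `F0/P3b/LH6-p01/g4/MAP-DATUM-ROAD.v3.LH6p01g4.md` row S12 «H-SIDE».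

WHAT.  The (S-𝔇) organ `stub_EllipticPackage` of `Cruxes/H413/Lines/F0_P3c_StCharTSPaydown.lean` (ED. 17) carries the socket (M1H)
★ `EllipticData.PacketCharHRegularity` [Rogawski1990 §1.6 p. 5 (characters on `H` as functions, Harish-Chandra); §12.5 p. 183 («Let `α` be a
stable class function on `H`», applied on p. 191 to `α = χ_ρ`, `ρ = St_H(ξ)`)]: for every square-integrable `L`-packet `ρ ∈ Π²(H)` the packet
character `χ_ρ = Σ_{σ ∈ ρ} χ_σ` (★ `packetCharH`) is measurable, locally integrable, a STABLE class function on `H^r` and on `H^e`, and computes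
`Σ_{σ ∈ ρ} Tr σ(f^H)` on `C_c^∞(H)`.  LH6-p01 (g4)'s junction ★-cand `F0P3cStCharTSDatumJunction.ellipticPackage_body_of_inputs` lists (M1H) among
its NAMED INPUTS verbatim.  This file splits it (the S9c trade: one bundled analytic input ↦ field bookkeeping + a sharper print residue):
* §0 (generic measure theory) `integrable_mul_of_isLocSmooth` — `f ∈ C_c^∞(H)` (★ `IsLocSmooth`: locally constant, compact support) times a
  locally integrable `Θ` is integrable (Mathlib `LocallyIntegrable.integrable_smul_left_of_hasCompactSupport`); hence finite sums of per-class
  trace identities are packet trace identities (`sum_smoothTrace_eq_integral_packetCharH`), and `packetCharH ρ` inherits measurability and local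
  integrability from the classes (`measurable_packetCharH`, `locallyIntegrable_packetCharH`);
* §1 the (M1H) DISCHARGE `packetCharHRegularity_of_charHFamily`: at any §12.5 datum `𝔇` whose H-side character field `charH` is a
  CHARACTER FAMILY in the sense of ★ «CHAR-FIELD★» (`F0P3cStCharTSCharField.exists_charFamily_of_characterLocallyIntegrable`: per class
  `σ`, `χ_σ` measurable, locally integrable for `μH`, representing `Tr σ` on `C_c^∞(H)` — the shape the SAME named fact ★
  `Ch1.characterLocallyIntegrable` [§1.6] delivers on `U(Φ₂)(L⁺_v) × U(Φ₁)(L⁺_v)` once the product-carrier plumbing is typed), whose packet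
  characters are STABLE class functions on `H^r` for `ρ ∈ Π²(H)` (the honest print residue, [§12.5 p. 183; §11.1]) and with the coherence
  (E⊆R)_H `H^e ⊆ H^r` (p. 184; LH6-p02 (g4)'s ★ `packetCharHRegularity_of_regH`), the socket (M1H) holds; variant `…_of_charHFamily_on` with the
  family asked only on the members of the packets of `Π²(H)`;
* §2 the instance on the organ's carriers `(U(Φ₃)(L⁺_v), H_v)` with `H_v` abstract (`packetCharHRegularity_Gqs_of_charHFamily`), the binder
  list the junction pastes.
HONEST LABEL: HC_CM is proved only modulo the 7 printed citations (2 remaining named inputs: hLiu418 = `stmt-HodgeConjecture-24832`, h413 =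
`stmt-HodgeConjecture-24833`) until rung 0 closes; this file closes no organ — it re-letters the socket (M1H) of (S-𝔇) at the future concrete
datum as «H-side character family (HC, §1.6) + stability of `χ_ρ` on `H^r` (§12.5 p. 183)» (count-neutral).

## References
* [Rogawski1990] J. D. Rogawski, *Automorphic Representations of Unitary Groups in Three Variables*, Ann. of Math. Stud. 123 (1990): §1.6
  pp. 5–6 (characters as locally integrable functions, «due to Harish-Chandra»); §12.5 p. 183 («Let `α` be a stable class function on `H`»,
  `α ↦ α^G`), p. 184 (`H^e`, `H^r`), p. 186 (`χ_ρ = Σ χ_π`); §12.7 p. 191 (`ρ = St_H(ξ)`).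
* [HarishChandra1999AdmissibleDistributions] Harish-Chandra (notes by DeBacker–Sally), *Admissible Invariant Distributions on Reductive
  p-adic Groups*, ULS 16 (1999), Thm. 16.3.
-/

set_option autoImplicit false
-- the mandated namespace has the single-problem summit's repeated segment (`HodgeConjecture.HodgeConjecture`)
set_option linter.dupNamespace false

noncomputable section

open MeasureTheory Filter Topology Set
open Literature.NumberTheory.Rogawski1990 Literature.NumberTheory.Automorphic
open Literature.NumberTheory.Rogawski1990.Ch12Sec5

namespace Summit.HodgeConjecture.HodgeConjecture.Cruxes.H413.F0P3cStCharTSM1hOfCharH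

/-! ## §0 Generic: `C_c^∞ × L¹_loc ⊂ L¹`, and packet characters as finite sums -/

section Generic

variable {X : Type*} [TopologicalSpace X] [MeasurableSpace X] [OpensMeasurableSpace X] [T2Space X] {μ : Measure X}

/-- **`C_c^∞ · L¹_loc ⊂ L¹`.**  If `Θ` is locally integrable and `f` is locally constant with compact support (★ `IsLocSmooth`, the
non-archimedean `C_c^∞`), then `f · Θ` is integrable — the convergence behind «`χ_π(f) = ∫ f(g) χ_π(g) dg`» for `f ∈ C(G, ω)`.
[cite: Rogawski1990, §1.6 pp. 5–6] -/
theorem integrable_mul_of_isLocSmooth {Θ f : X → ℂ} (hΘ : LocallyIntegrable Θ μ) (hf : IsLocSmooth f) :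
    Integrable (fun x => f x * Θ x) μ := by
  have h := hΘ.integrable_smul_left_of_hasCompactSupport hf.1.continuous hf.2
  simpa only [smul_eq_mul] using h

end Generic

section Datum

variable {G H : Type} [Group G] [TopologicalSpace G] [IsTopologicalGroup G] [MeasurableSpace G]
  [∀ γ : G, MeasurableSpace (G ⧸ Subgroup.centralizer ({γ} : Set G))] [MeasurableSpace (G ⧸ Subgroup.center G)]
  [Group H] [TopologicalSpace H] [IsTopologicalGroup H] [MeasurableSpace H]

/-- `χ_ρ = Σ_{σ ∈ ρ} χ_σ` is measurable when the member characters are. [cite: Rogawski1990, §12.5 p. 186] -/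
theorem measurable_packetCharH (𝔇 : EllipticData G H) (ρ : Finset (IrrClass H))
    (h : ∀ σ ∈ ρ, Measurable (𝔇.charH σ)) : Measurable (𝔇.packetCharH ρ) := by
  have : 𝔇.packetCharH ρ = fun x => ∑ σ ∈ ρ, 𝔇.charH σ x := by
    funext x; rfl
  rw [this]
  exact Finset.measurable_sum ρ h

/-- `χ_ρ = Σ_{σ ∈ ρ} χ_σ` is locally integrable when the member characters are. [cite: Rogawski1990, §1.6 p. 5; §12.5 p. 186] -/
theorem locallyIntegrable_packetCharH (𝔇 : EllipticData G H) (ρ : Finset (IrrClass H))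
    (h : ∀ σ ∈ ρ, LocallyIntegrable (𝔇.charH σ) 𝔇.μH) : LocallyIntegrable (𝔇.packetCharH ρ) 𝔇.μH := by
  have : 𝔇.packetCharH ρ = fun x => ∑ σ ∈ ρ, 𝔇.charH σ x := by
    funext x; rfl
  rw [this]
  exact locallyIntegrable_finsetSum ρ h

/-- **The packet trace identity from the member trace identities**: if every member character `χ_σ`, `σ ∈ ρ`, is locally integrable and
represents `Tr σ` on `C_c^∞(H)`, then `Σ_{σ ∈ ρ} Tr σ(f) = ∫ f · χ_ρ` for every `f ∈ C_c^∞(H)` (finite sum of integrals of integrable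
functions, §0). [cite: Rogawski1990, §1.6 p. 5; §12.5 p. 186] -/
theorem sum_smoothTrace_eq_integral_packetCharH [OpensMeasurableSpace H] [T2Space H]
    (𝔇 : EllipticData G H) (ρ : Finset (IrrClass H))
    (hli : ∀ σ ∈ ρ, LocallyIntegrable (𝔇.charH σ) 𝔇.μH)
    (htr : ∀ σ ∈ ρ, ∀ fH : H → ℂ, IsLocSmooth fH → σ.smoothTrace 𝔇.μH fH = ∫ h, fH h * 𝔇.charH σ h ∂𝔇.μH)
    (fH : H → ℂ) (hfH : IsLocSmooth fH) :
    (∑ σ ∈ ρ, σ.smoothTrace 𝔇.μH fH) = ∫ h, fH h * 𝔇.packetCharH ρ h ∂𝔇.μH := by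
  have hint : ∀ σ ∈ ρ, Integrable (fun h => fH h * 𝔇.charH σ h) 𝔇.μH :=
    fun σ hσ => integrable_mul_of_isLocSmooth (hli σ hσ) hfH
  calc (∑ σ ∈ ρ, σ.smoothTrace 𝔇.μH fH) = ∑ σ ∈ ρ, ∫ h, fH h * 𝔇.charH σ h ∂𝔇.μH :=
        Finset.sum_congr rfl fun σ hσ => htr σ hσ fH hfH
    _ = ∫ h, ∑ σ ∈ ρ, fH h * 𝔇.charH σ h ∂𝔇.μH := (integral_finsetSum ρ hint).symm
    _ = ∫ h, fH h * 𝔇.packetCharH ρ h ∂𝔇.μH := by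
        refine integral_congr_ae (Eventually.of_forall fun h => ?_)
        show ∑ σ ∈ ρ, fH h * 𝔇.charH σ h = fH h * ∑ σ ∈ ρ, 𝔇.charH σ h
        rw [Finset.mul_sum]

/-! ## §1 The (M1H) discharge: character family on `H` + stability on `H^r` + (E⊆R)_H -/

/-- **(M1H) `PacketCharHRegularity` FROM A CHARACTER FAMILY ON `H` — members-only form.**  At a §12.5 datum `𝔇` with (E⊆R)_H
`H^e ⊆ H^r`, suppose that for every `ρ ∈ Π²(H)` and every member `σ ∈ ρ` the H-side character `χ_σ = 𝔇.charH σ` is measurable, locally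
integrable for `μH` and represents `Tr σ` on `C_c^∞(H)` (Harish-Chandra on `H`, [§1.6 p. 5]), and that `χ_ρ` is a STABLE class function on
`H^r` ([§12.5 p. 183] «Let `α` be a stable class function on `H`» — the print residue of (M1H)).  Then the socket (M1H) holds.
[cite: Rogawski1990, §1.6 pp. 5–6; §12.5 pp. 183–184, 186] [cite: HarishChandra1999AdmissibleDistributions, Thm. 16.3] -/
theorem packetCharHRegularity_of_charHFamily_on [OpensMeasurableSpace H] [T2Space H] (𝔇 : EllipticData G H)
    (hEHR : 𝔇.ellH ⊆ 𝔇.regH)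
    (hcharH : ∀ ρ ∈ 𝔇.sqPacketsH, ∀ σ ∈ ρ, Measurable (𝔇.charH σ) ∧ LocallyIntegrable (𝔇.charH σ) 𝔇.μH ∧
      ∀ fH : H → ℂ, IsLocSmooth fH → σ.smoothTrace 𝔇.μH fH = ∫ h, fH h * 𝔇.charH σ h ∂𝔇.μH)
    (hstab : ∀ ρ ∈ 𝔇.sqPacketsH, IsStableClassFunOn 𝔇.stConjH 𝔇.regH (𝔇.packetCharH ρ)) :
    𝔇.PacketCharHRegularity := by
  refine F0P3cStCharTSSocketsOut.packetCharHRegularity_of_regH 𝔇 hEHR fun ρ hρ => ?_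
  refine ⟨measurable_packetCharH 𝔇 ρ fun σ hσ => (hcharH ρ hρ σ hσ).1,
    locallyIntegrable_packetCharH 𝔇 ρ fun σ hσ => (hcharH ρ hρ σ hσ).2.1, hstab ρ hρ, ?_⟩
  exact sum_smoothTrace_eq_integral_packetCharH 𝔇 ρ (fun σ hσ => (hcharH ρ hρ σ hσ).2.1)
    (fun σ hσ => (hcharH ρ hρ σ hσ).2.2)

/-- **(M1H) `PacketCharHRegularity` FROM A CHARACTER FAMILY ON `H`** (the junction's binder shape): at a §12.5 datum `𝔇` whose H-side
character field is a CHARACTER FAMILY — for EVERY class `σ` of `H`, `χ_σ` is measurable, locally integrable for `μH` and represents `Tr σ` on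
`C_c^∞(H)` (exactly what ★ «CHAR-FIELD★» `exists_charFamily_of_characterLocallyIntegrable` delivers from the named fact ★
`Ch1.characterLocallyIntegrable` [§1.6] on a unitary group, to be instantiated on `H_v = U(Φ₂)(L⁺_v) × U(Φ₁)(L⁺_v)`) — whose packet characters
`χ_ρ`, `ρ ∈ Π²(H)`, are STABLE class functions on `H^r` [§12.5 p. 183], and with (E⊆R)_H `H^e ⊆ H^r` [p. 184], the socket (M1H) of (S-𝔇)
holds. [cite: Rogawski1990, §1.6 pp. 5–6; §12.5 pp. 183–184, 186] [cite: HarishChandra1999AdmissibleDistributions, Thm. 16.3] -/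
theorem packetCharHRegularity_of_charHFamily [OpensMeasurableSpace H] [T2Space H] (𝔇 : EllipticData G H)
    (hEHR : 𝔇.ellH ⊆ 𝔇.regH)
    (hcharH : ∀ σ : IrrClass H, Measurable (𝔇.charH σ) ∧ LocallyIntegrable (𝔇.charH σ) 𝔇.μH ∧
      ∀ fH : H → ℂ, IsLocSmooth fH → σ.smoothTrace 𝔇.μH fH = ∫ h, fH h * 𝔇.charH σ h ∂𝔇.μH)
    (hstab : ∀ ρ ∈ 𝔇.sqPacketsH, IsStableClassFunOn 𝔇.stConjH 𝔇.regH (𝔇.packetCharH ρ)) :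
    𝔇.PacketCharHRegularity :=
  packetCharHRegularity_of_charHFamily_on 𝔇 hEHR (fun _ _ σ _ => hcharH σ) hstab

/-- **(M1H) at a datum with a SINGLE square-integrable `H`-packet `{πSt}`** (the organ's COMPAT asks only `{St_H(ξ_v)} ∈ Π²(H)`; a constructor
taking `Π²(H) := {{πSt}}` owes (M1H) for that packet alone): the character `χ_{πSt}` measurable, locally integrable, representing `Tr πSt`,
and a stable class function on `H^r` [§12.5 p. 183; §12.7 p. 191, `ρ = St_H(ξ)`], plus (E⊆R)_H, give (M1H).
[cite: Rogawski1990, §1.6 p. 5; §12.5 pp. 183–184; §12.7 p. 191] -/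
theorem packetCharHRegularity_of_singleton [OpensMeasurableSpace H] [T2Space H] (𝔇 : EllipticData G H) (πSt : IrrClass H)
    (hsq : 𝔇.sqPacketsH = {({πSt} : Finset (IrrClass H))})
    (hEHR : 𝔇.ellH ⊆ 𝔇.regH)
    (hm : Measurable (𝔇.charH πSt)) (hli : LocallyIntegrable (𝔇.charH πSt) 𝔇.μH)
    (htr : ∀ fH : H → ℂ, IsLocSmooth fH → πSt.smoothTrace 𝔇.μH fH = ∫ h, fH h * 𝔇.charH πSt h ∂𝔇.μH)
    (hstab : IsStableClassFunOn 𝔇.stConjH 𝔇.regH (𝔇.charH πSt)) :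
    𝔇.PacketCharHRegularity := by
  have hpk : 𝔇.packetCharH {πSt} = 𝔇.charH πSt := by
    funext h
    show ∑ σ ∈ ({πSt} : Finset (IrrClass H)), 𝔇.charH σ h = 𝔇.charH πSt h
    rw [Finset.sum_singleton]
  refine packetCharHRegularity_of_charHFamily_on 𝔇 hEHR (fun ρ hρ σ hσ => ?_) (fun ρ hρ => ?_)
  · rw [hsq, Set.mem_singleton_iff] at hρ
    subst hρ
    rw [Finset.mem_singleton] at hσ
    subst hσ
    exact ⟨hm, hli, htr⟩
  · rw [hsq, Set.mem_singleton_iff] at hρ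
    subst hρ
    rw [hpk]
    exact hstab

end Datum

/-! ## §2 The instance on the organ's carriers `(U(Φ₃)(L⁺_v), H_v)` -/

section U3

open NumberField IsDedekindDomain
open Literature.NumberTheory.Automorphic.UnitaryGroup

variable (L : Type) [Field L] [NumberField L] [IsCMField L] (v : HeightOneSpectrum (𝓞 ↥(maximalRealSubfield L)))

/-- **(M1H) ON `(U(Φ₃)(L⁺_v), H_v)`**, `H_v` any carrier with the organ's σ-algebra (`BorelSpace`) and Haar measure `νHv`: at every §12.5
datum `𝔇` on `(U(Φ₃)(L⁺_v), H_v)` with COMPAT `𝔇.μH = νHv`, an H-side character family (per class: measurable, locally integrable for `νHv`,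
representing `Tr σ` on `C_c^∞(H_v)` — [§1.6 p. 5]), stable packet characters on `H^r` for `ρ ∈ Π²(H)` [§12.5 p. 183] and (E⊆R)_H, the
socket (M1H) `𝔇.PacketCharHRegularity` holds — the binder list for the junction.
[cite: Rogawski1990, §1.6 pp. 5–6; §12.5 pp. 183–184] [cite: HarishChandra1999AdmissibleDistributions, Thm. 16.3] -/
theorem packetCharHRegularity_Gqs_of_charHFamily
    [MeasurableSpace (Gqs L v)]
    [∀ γ : Gqs L v, MeasurableSpace (Gqs L v ⧸ Subgroup.centralizer ({γ} : Set (Gqs L v)))]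
    [MeasurableSpace (Gqs L v ⧸ Subgroup.center (Gqs L v))]
    {H' : Type} [Group H'] [TopologicalSpace H'] [IsTopologicalGroup H'] [MeasurableSpace H'] [BorelSpace H'] [T2Space H']
    (νHv : Measure H') (𝔇 : EllipticData (Gqs L v) H') (hμH : 𝔇.μH = νHv)
    (hEHR : 𝔇.ellH ⊆ 𝔇.regH)
    (hcharH : ∀ σ : IrrClass H', Measurable (𝔇.charH σ) ∧ LocallyIntegrable (𝔇.charH σ) νHv ∧
      ∀ fH : H' → ℂ, IsLocSmooth fH → σ.smoothTrace νHv fH = ∫ h, fH h * 𝔇.charH σ h ∂νHv)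
    (hstab : ∀ ρ ∈ 𝔇.sqPacketsH, IsStableClassFunOn 𝔇.stConjH 𝔇.regH (𝔇.packetCharH ρ)) :
    𝔇.PacketCharHRegularity := by
  subst hμH
  exact packetCharHRegularity_of_charHFamily 𝔇 hEHR hcharH hstab

end U3

end Summit.HodgeConjecture.HodgeConjecture.Cruxes.H413.F0P3cStCharTSM1hOfCharH

end
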